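import Literature.NumberTheory.Automorphic.ArchCasimirInvolution
import Literature.NumberTheory.Automorphic.ArchGardingOneParamDeriv
import Literature.NumberTheory.Automorphic.ArchWhittakerInfinitesimal
import HarnessLib

/-!
# One-parameter derivatives of distributions on `GL_n(K_∞)`: the infinitesimal form of
# quasi-invariance

Topic `NumberTheory/Automorphic`; namespace `Literature.NumberTheory.Automorphic`. For a distribution `T`
on `G_∞ = GL_n(K_∞)` in the sense of the tree (`IsArchDistribution`: on every compact `κ` a bound
`|T f| ≤ C · max_{(u,v) ∈ 𝒮} sup |L_u R_v f|` for the test functions supported in `κ`), the orbit maps of the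
regular representations are differentiable **in the weak sense**:

* `IsArchDistribution.hasDerivAt_apply_leftTranslate_expGL` — `s ↦ T(λ(exp sX) f)` has derivative
  `T(L_X f)` at `s = 0` (`λ(g) f = f(g⁻¹ ·)`, `L_X f = d/ds|₀ f(exp(-sX) ·)`); proof: the flow defect
  `λ_s f - f - s L_X f` is a test function supported in the fixed compact `flowSupportSet X f` for `|s| ≤ 1`,
  and all its seminorms `sup |L_u R_v ·|` are `o(s)` uniformly (`exists_forall_norm_flowDefect_le` of
  `ArchGardingOneParamDeriv`, applied to the test function `R_v f`, right words commuting with left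
  translations), so the distribution bound gives `|T(λ_s f) - T f - s T(L_X f)| = o(s)`;
* `IsArchDistribution.hasDerivAt_apply_rightTranslate_expGL` — `s ↦ T(ρ(exp sX) f)` has derivative
  `T(R_X f)` (`ρ(g) f = f(· g)`), deduced from the left statement for `T ∘ ι` through
  `ι(ρ(g) f) = λ(ι(g)⁻¹)(ι f)`, `ι(exp sX) = exp(s X♯)` and `L_{-X♯}(f ∘ ι) = (R_X f) ∘ ι`;
* the **infinitesimal quasi-invariance**: if `T(λ(exp sX) f) = e^{s c} T f` for all `s` then
  `T(L_X f) = c · T f` (`apply_leftDeriv_eq_of_leftTranslate_expGL`), and the right analogue; in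
  particular for a left `(N, ψ_∞)`-quasi-invariant `T` and a root vector `X = x E_{ij}`, `i < j`,
  `T(L_X f) = ψ_∞'(X) T f` with `ψ_∞'(x E_{ij}) = -2πi Tr_{K_∞/ℝ}(x) [j = i+1]` (`archWhittakerDChar`), and
  `T(R_X f) = -ψ_∞'(X) T f` for a right `(N, ψ_∞⁻¹)`-quasi-invariant `T`
  (`apply_leftDeriv_single_of_leftQuasiInvariant`, `apply_rightDeriv_single_of_rightQuasiInvariant`).

These are the first-order identities `T((L_Y - ψ'(Y)) f) = 0`, `T((R_X + ψ'(X)) f) = 0` with which the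
quasi-invariant distributions on the small Bruhat cells are analysed (Shalika (1974), §2). Everything is
proved; no definition and no named fact is introduced.

## References

* J. A. Shalika, *The multiplicity one theorem for `GL_n`*, Ann. of Math. 100 (1974), §2 [Shalika1974].
* L. Hörmander, *The Analysis of Linear Partial Differential Operators I* (1983), Thm. 2.1.3, §3.1
  [HormanderALPDO1].
-/

noncomputable section

open MeasureTheory Measure NumberField NumberField.mixedEmbedding NumberField.InfinitePlace IsDedekindDomain Set Filter
open scoped MatrixGroups Topology Classical ContDiff Matrix.Norms.Operator ComplexConjugate

namespace Literature.NumberTheory.Automorphic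

variable {n : ℕ} {K : Type} [Field K] [NumberField K]

attribute [local instance] glInfBorel borelSpace_glInf locallyCompactSpace_glInf
  secondCountableTopology_glInf

-- Mathlib idiom (Mathlib/Algebra/Lie/OfAssociative.lean): the commutator Lie ring on matrices
attribute [local instance 100] LieRing.ofAssociativeRing

-- as in `ArchGardingWhittaker`: the scoped `L∞`-operator normed ring structure on matrices is only
-- reducibly defeq to the Pi uniformity
set_option backward.isDefEq.respectTransparency false

local notation "Mat" => Matrix (Fin n) (Fin n) (mixedSpace K)
local notation "G∞" => GL (Fin n) (mixedSpace K)
local notation "R∞" => mixedSpace K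

/-! ### 1. Right words and left translations; supports of flow defects -/

section Prelim

/-- `R_v (α(a ·)) = (R_v α)(a ·)`: right words commute with left translations. [folklore] -/
theorem archRightWordDeriv_comp_mul_left (α : G∞ → ℂ) (a : G∞) :
    ∀ v : List Mat, archRightWordDeriv v (fun h => α (a * h)) = fun y => archRightWordDeriv v α (a * y)
  | [] => rfl
  | X :: v => by
    rw [archRightWordDeriv_cons, archRightWordDeriv_cons, archRightWordDeriv_comp_mul_left α a v]
    funext y
    exact archRightDeriv_comp_mul_left X (archRightWordDeriv v α) a y

/-- `R_v (α - β) = R_v α - R_v β` on test functions. [folklore] -/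
theorem IsArchTestFunction.archRightWordDeriv_sub {α β : G∞ → ℂ} (hα : IsArchTestFunction n K α)
    (hβ : IsArchTestFunction n K β) (v : List Mat) :
    Automorphic.archRightWordDeriv v (α - β) =
      Automorphic.archRightWordDeriv v α - Automorphic.archRightWordDeriv v β := by
  have hn : IsArchTestFunction n K (-β) := by simpa using hβ.smul (-1)
  have h := hα.archRightWordDeriv_add hn v
  have hneg : Automorphic.archRightWordDeriv v (-β) = -Automorphic.archRightWordDeriv v β := by
    simpa using Automorphic.archRightWordDeriv_smul (-1 : ℂ) β v
  rw [sub_eq_add_neg, h, hneg, ← sub_eq_add_neg]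

/-- `R_v (λ_s α) = λ_s (R_v α)`. [folklore] -/
theorem archRightWordDeriv_archLeftFlow (X : Mat) (s : ℝ) (α : G∞ → ℂ) (v : List Mat) :
    archRightWordDeriv v (archLeftFlow X s α) = archLeftFlow X s (archRightWordDeriv v α) :=
  archRightWordDeriv_comp_mul_left α ((expGL (s • X) :))⁻¹ v

/-- `tsupport α ⊆ flowSupportSet X α`. [folklore] -/
theorem tsupport_subset_flowSupportSet (X : Mat) (α : G∞ → ℂ) : tsupport α ⊆ flowSupportSet X α := by
  intro y hy
  refine ⟨(0, y), ⟨⟨by norm_num, by norm_num⟩, hy⟩, ?_⟩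
  change expGL ((0 : ℝ) • X) * y = y
  rw [zero_smul, expGL_zero, one_mul]

/-- `tsupport (λ_s α) ⊆ flowSupportSet X α` for `|s| ≤ 1`. [folklore] -/
theorem tsupport_archLeftFlow_subset_flowSupportSet (X : Mat) (α : G∞ → ℂ) {s : ℝ} (hs : |s| ≤ 1) :
    tsupport (archLeftFlow X s α) ⊆ flowSupportSet X α := by
  intro y hy
  obtain ⟨h, hh, rfl⟩ := tsupport_archLeftFlow_subset X s α hy
  exact ⟨(s, h), ⟨⟨(abs_le.1 hs).1, (abs_le.1 hs).2⟩, hh⟩, rfl⟩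

/-- The flow defect `λ_s α - α - s L_X α` is supported in `flowSupportSet X α` for `|s| ≤ 1`. [folklore] -/
theorem tsupport_flowDefect_subset (X : Mat) (α : G∞ → ℂ) {s : ℝ} (hs : |s| ≤ 1) :
    tsupport (archLeftFlow X s α - α - (s : ℂ) • archLeftDeriv X α) ⊆ flowSupportSet X α := by
  have h1 := tsupport_archLeftFlow_subset_flowSupportSet X α hs
  have h2 := tsupport_subset_flowSupportSet X α
  have h3 : tsupport ((s : ℂ) • archLeftDeriv X α) ⊆ flowSupportSet X α :=
    ((tsupport_smul_subset_right (fun _ : G∞ => (s : ℂ)) (archLeftDeriv X α)).trans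
      (tsupport_archLeftDeriv_subset α X)).trans h2
  have hneg : ∀ γ : G∞ → ℂ, tsupport (-γ) = tsupport γ := fun γ => by
    rw [tsupport, tsupport, Function.support_neg]
  rw [sub_eq_add_neg, sub_eq_add_neg]
  refine (tsupport_add _ _).trans (union_subset ((tsupport_add _ _).trans (union_subset h1 ?_)) ?_)
  · rw [hneg]; exact h2
  · rw [hneg]; exact h3

omit [NumberField K] in
/-- `(-X)♯ = -X♯`. [folklore] -/
theorem weylSharp_neg' (X : Mat) : weylSharp (-X) = -weylSharp X := by
  simp only [weylSharp, Matrix.transpose_neg, Matrix.mul_neg, Matrix.neg_mul]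

/-- `λ(1) f = f`. [folklore] -/
theorem archTestFunctions.leftTranslate_one_eq (f : ↥(archTestFunctions n K)) :
    archTestFunctions.leftTranslate (1 : G∞) f = f :=
  Subtype.ext (funext fun x => by rw [archTestFunctions.leftTranslate_apply, inv_one, one_mul])

end Prelim

/-! ### 2. The weak derivative of `s ↦ T(λ(exp sX) f)` -/

section Left

variable {T : ↥(archTestFunctions n K) →ₗ[ℂ] ℂ}

/-- The flow defect as an element of the test space. [folklore] -/
theorem coe_leftTranslate_expGL_sub_sub_smul (X : Mat) (s : ℝ) (f : ↥(archTestFunctions n K)) :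
    ((archTestFunctions.leftTranslate (expGL (s • X) :) f - f - (s : ℂ) • archTestFunctions.leftDeriv X f :
        ↥(archTestFunctions n K)) : G∞ → ℂ) =
      archLeftFlow X s (f : G∞ → ℂ) - (f : G∞ → ℂ) - (s : ℂ) • archLeftDeriv X (f : G∞ → ℂ) := by
  rw [Submodule.coe_sub, Submodule.coe_sub, Submodule.coe_smul, archTestFunctions.leftDeriv_apply]
  rfl

/-- The seminorms of the flow defect: `L_u R_v (λ_s f - f - s L_X f) = L_u(λ_s f_v) - L_u f_v - s L_u L_X f_v`
with `f_v = R_v f`. [folklore] -/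
theorem archLeftWordDeriv_archRightWordDeriv_flowDefect {α : G∞ → ℂ} (hα : IsArchTestFunction n K α)
    (X : Mat) (s : ℝ) (u v : List Mat) :
    archLeftWordDeriv u (archRightWordDeriv v (archLeftFlow X s α - α - (s : ℂ) • archLeftDeriv X α)) =
      archLeftWordDeriv u (archLeftFlow X s (archRightWordDeriv v α)) - archLeftWordDeriv u (archRightWordDeriv v α) -
        (s : ℂ) • archLeftWordDeriv u (archLeftDeriv X (archRightWordDeriv v α)) := by
  have hv : IsArchTestFunction n K (archRightWordDeriv v α) := hα.archRightWordDeriv v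
  have h1 : archRightWordDeriv v (archLeftFlow X s α - α - (s : ℂ) • archLeftDeriv X α) =
      archLeftFlow X s (archRightWordDeriv v α) - archRightWordDeriv v α -
        (s : ℂ) • archLeftDeriv X (archRightWordDeriv v α) := by
    rw [(((hα.archLeftFlow X s).sub hα)).archRightWordDeriv_sub ((hα.archLeftDeriv X).smul (s : ℂ)) v,
      (hα.archLeftFlow X s).archRightWordDeriv_sub hα v, archRightWordDeriv_smul,
      archRightWordDeriv_archLeftFlow, ← archLeftDeriv_archRightWordDeriv_comm hα X v]
  rw [h1, ((hv.archLeftFlow X s).sub hv).archLeftWordDeriv_sub ((hv.archLeftDeriv X).smul (s : ℂ)) u,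
    (hv.archLeftFlow X s).archLeftWordDeriv_sub hv u, archLeftWordDeriv_smul]

/-- Linearity: `T(λ_s f) - T f - s T(L_X f) = T(λ_s f - f - s L_X f)`. [folklore] -/
theorem apply_leftTranslate_expGL_sub_sub (T : ↥(archTestFunctions n K) →ₗ[ℂ] ℂ) (X : Mat) (s : ℝ)
    (f : ↥(archTestFunctions n K)) :
    T (archTestFunctions.leftTranslate (expGL (s • X) :) f) - T f - (s : ℂ) * T (archTestFunctions.leftDeriv X f) =
      T (archTestFunctions.leftTranslate (expGL (s • X) :) f - f - (s : ℂ) • archTestFunctions.leftDeriv X f) := by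
  rw [map_sub, map_sub, map_smul, smul_eq_mul]

/-- The flow defect in the test space is supported in `flowSupportSet X f` for `|s| ≤ 1`. [folklore] -/
theorem tsupport_coe_leftTranslate_expGL_sub_sub_subset (X : Mat) (f : ↥(archTestFunctions n K)) {s : ℝ}
    (hs : |s| ≤ 1) :
    tsupport (((archTestFunctions.leftTranslate (expGL (s • X) :) f - f -
        (s : ℂ) • archTestFunctions.leftDeriv X f : ↥(archTestFunctions n K))) : G∞ → ℂ) ⊆
      flowSupportSet X (f : G∞ → ℂ) := by
  rw [coe_leftTranslate_expGL_sub_sub_smul]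
  exact tsupport_flowDefect_subset X _ hs

/-- The distribution bound applied to the flow defect: `|T(λ_s f) - T f - s T(L_X f)| ≤ C ε |s|` once the
seminorms of the defect are `≤ ε |s|`. [folklore] -/
theorem norm_apply_leftTranslate_sub_sub_le {X : Mat} {f : ↥(archTestFunctions n K)} {C : ℝ}
    {𝒮 : Finset (List Mat × List Mat)}
    (hb : ∀ g : ↥(archTestFunctions n K), tsupport (g : G∞ → ℂ) ⊆ flowSupportSet X (f : G∞ → ℂ) →
      ∀ M : ℝ, (∀ p ∈ 𝒮, ∀ y : G∞,
        ‖archLeftWordDeriv p.1 (archRightWordDeriv p.2 (g : G∞ → ℂ)) y‖ ≤ M) → ‖T g‖ ≤ C * M)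
    {s ε : ℝ} (hs : |s| ≤ 1)
    (hε : ∀ p ∈ 𝒮, ∀ y : G∞,
      ‖archLeftWordDeriv p.1 (archLeftFlow X s (archRightWordDeriv p.2 (f : G∞ → ℂ))) y -
          archLeftWordDeriv p.1 (archRightWordDeriv p.2 (f : G∞ → ℂ)) y -
          (s : ℂ) * archLeftWordDeriv p.1 (archLeftDeriv X (archRightWordDeriv p.2 (f : G∞ → ℂ))) y‖ ≤ ε * |s|) :
    ‖T (archTestFunctions.leftTranslate (expGL (s • X) :) f) - T f - (s : ℂ) * T (archTestFunctions.leftDeriv X f)‖ ≤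
      C * (ε * |s|) := by
  rw [apply_leftTranslate_expGL_sub_sub T X s f]
  refine hb _ (tsupport_coe_leftTranslate_expGL_sub_sub_subset X f hs) _ fun p hp y => ?_
  rw [coe_leftTranslate_expGL_sub_sub_smul, archLeftWordDeriv_archRightWordDeriv_flowDefect f.2 X s p.1 p.2,
    Pi.sub_apply, Pi.sub_apply, Pi.smul_apply, smul_eq_mul]
  exact hε p hp y

/-- **`s ↦ T(λ(exp sX) f)` has derivative `T(L_X f)` at `s = 0`** for every distribution `T` on `GL_n(K_∞)`,
every test function `f` and every `X ∈ 𝔤𝔩_n(K_∞)` (differentiation under a distribution along a one-parameter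
group; Hörmander, Thm. 2.1.3 and §3.1). [cite: HormanderALPDO1, Thm. 2.1.3] -/
theorem IsArchDistribution.hasDerivAt_apply_leftTranslate_expGL (hT : IsArchDistribution n K T) (X : Mat)
    (f : ↥(archTestFunctions n K)) :
    HasDerivAt (fun s : ℝ => T (archTestFunctions.leftTranslate (expGL (s • X) :) f))
      (T (archTestFunctions.leftDeriv X f)) 0 := by
  have hα : IsArchTestFunction n K (f : G∞ → ℂ) := f.2
  obtain ⟨C, 𝒮, hC0, hb⟩ := hT (flowSupportSet X (f : G∞ → ℂ)) (isCompact_flowSupportSet hα X)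
  rw [hasDerivAt_iff_isLittleO_nhds_zero, Asymptotics.isLittleO_iff]
  intro c hc
  obtain ⟨ε, hε, hCε⟩ : ∃ ε : ℝ, 0 < ε ∧ C * ε ≤ c :=
    ⟨c / (C + 1), div_pos hc (by linarith), by
      rw [mul_div_assoc', div_le_iff₀ (by linarith : (0 : ℝ) < C + 1)]; nlinarith⟩
  -- the uniform `o(s)` bounds for the finitely many seminorms
  have hmain : ∀ p ∈ 𝒮, ∀ᶠ s in 𝓝 (0 : ℝ), ∀ y : G∞,
      ‖archLeftWordDeriv p.1 (archLeftFlow X s (archRightWordDeriv p.2 (f : G∞ → ℂ))) y -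
          archLeftWordDeriv p.1 (archRightWordDeriv p.2 (f : G∞ → ℂ)) y -
          (s : ℂ) * archLeftWordDeriv p.1 (archLeftDeriv X (archRightWordDeriv p.2 (f : G∞ → ℂ))) y‖ ≤ ε * |s| := by
    intro p _
    obtain ⟨δ, hδ, hδb⟩ := exists_forall_norm_flowDefect_le (hα.archRightWordDeriv p.2) X p.1 hε
    refine Metric.eventually_nhds_iff.2 ⟨δ, hδ, fun s hs y => ?_⟩
    rw [Real.dist_eq, sub_zero] at hs
    have h := hδb s hs y
    rwa [Complex.real_smul] at h
  have hsmall : ∀ᶠ s in 𝓝 (0 : ℝ), |s| < 1 := by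
    refine Metric.eventually_nhds_iff.2 ⟨1, one_pos, fun s hs => ?_⟩
    rwa [Real.dist_eq, sub_zero] at hs
  filter_upwards [(𝒮.eventually_all).2 hmain, hsmall] with s hs hs1
  -- NB: `(expGL _ :)` is elaborated before unifying with `GL_n(K_∞)` (else an expensive instance unification)
  simp only [zero_add, zero_smul, expGL_zero, archTestFunctions.leftTranslate_one_eq, Complex.real_smul,
    Real.norm_eq_abs]
  refine (norm_apply_leftTranslate_sub_sub_le hb hs1.le hs).trans ?_
  have h := mul_le_mul_of_nonneg_right hCε (abs_nonneg s)
  calc C * (ε * |s|) = C * ε * |s| := by ring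
    _ ≤ c * |s| := h

/-- **Infinitesimal quasi-invariance, left**: if `T(λ(exp sX) f) = e^{s c} · T f` for all real `s`, then
`T(L_X f) = c · T f`. [cite: Shalika1974, §2] -/
theorem IsArchDistribution.apply_leftDeriv_eq_of_leftTranslate_expGL (hT : IsArchDistribution n K T) {X : Mat}
    {c : ℂ} (f : ↥(archTestFunctions n K))
    (h : ∀ s : ℝ, T (archTestFunctions.leftTranslate (expGL (s • X) :) f) = Complex.exp (s * c) * T f) :
    T (archTestFunctions.leftDeriv X f) = c * T f := by
  have h1 := hT.hasDerivAt_apply_leftTranslate_expGL X f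
  have h2 : HasDerivAt (fun s : ℝ => Complex.exp (s * c) * T f) (c * T f) 0 := by
    have he : HasDerivAt (fun s : ℝ => Complex.exp (s * c)) (Complex.exp ((0 : ℝ) * c) * c) 0 := by
      have hlin : HasDerivAt (fun s : ℝ => (s : ℂ) * c) c (0 : ℝ) := by
        simpa using (Complex.ofRealCLM.hasDerivAt (x := (0 : ℝ))).mul_const c
      exact (Complex.hasDerivAt_exp _).comp (0 : ℝ) hlin |>.congr_deriv (by ring)
    have := he.mul_const (T f)
    simpa using this
  simp_rw [h] at h1
  exact h1.unique h2

end Left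

/-! ### 3. The right translations, through `ι` -/

section Right

variable {T : ↥(archTestFunctions n K) →ₗ[ℂ] ℂ}

/-- `ι(ρ(g) f) = λ(ι(g)⁻¹)(ι f)`: the involution `f ↦ f ∘ ι` exchanges right and left translations. [folklore] -/
theorem compGKInvolution_rightTranslate (g : G∞) (f : ↥(archTestFunctions n K)) :
    archTestFunctions.compGKInvolution (archTestFunctions.rightTranslate g f) =
      archTestFunctions.leftTranslate (gkInvolution g)⁻¹ (archTestFunctions.compGKInvolution f) := by
  refine Subtype.ext (funext fun x => ?_)
  simp only [archTestFunctions.compGKInvolution_apply, archTestFunctions.rightTranslate_apply,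
    archTestFunctions.leftTranslate_apply, inv_inv, gkInvolution_mul, gkInvolution_gkInvolution]

/-- `ι(exp(sX))⁻¹ = exp(s · (-X♯))`. [folklore] -/
theorem gkInvolution_expGL_smul_inv (s : ℝ) (X : Mat) :
    (gkInvolution (expGL (s • X) :))⁻¹ = (expGL (s • (-weylSharp X)) :) := by
  rw [gkInvolution_expGL, weylSharp_smul_real, smul_neg, expGL_neg]

/-- `L_{-X♯}(f ∘ ι) = (R_X f) ∘ ι` on the test space. [folklore] -/
theorem leftDeriv_neg_weylSharp_compGKInvolution (X : Mat) (f : ↥(archTestFunctions n K)) :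
    archTestFunctions.leftDeriv (-weylSharp X) (archTestFunctions.compGKInvolution f) =
      archTestFunctions.compGKInvolution (archTestFunctions.rightDeriv X f) := by
  refine Subtype.ext (funext fun y => ?_)
  rw [archTestFunctions.leftDeriv_apply, archTestFunctions.compGKInvolution_apply,
    archTestFunctions.rightDeriv_apply]
  have h := archLeftDeriv_comp_gkInvolution (-weylSharp X) (f : G∞ → ℂ) y
  rw [weylSharp_neg', neg_neg, weylSharp_weylSharp] at h
  exact h

/-- `T f = (T ∘ ι)(ι f)`. [folklore] -/
theorem apply_eq_comp_compGKInvolution (T : ↥(archTestFunctions n K) →ₗ[ℂ] ℂ) (f : ↥(archTestFunctions n K)) :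
    T f = (T.comp archTestFunctions.compGKInvolution) (archTestFunctions.compGKInvolution f) := by
  rw [LinearMap.comp_apply, archTestFunctions.compGKInvolution_compGKInvolution]

/-- **`s ↦ T(ρ(exp sX) f)` has derivative `T(R_X f)` at `s = 0`** for every distribution `T` on
`GL_n(K_∞)` (from the left statement for `T ∘ ι`). [cite: HormanderALPDO1, Thm. 2.1.3] -/
theorem IsArchDistribution.hasDerivAt_apply_rightTranslate_expGL (hT : IsArchDistribution n K T) (X : Mat)
    (f : ↥(archTestFunctions n K)) :
    HasDerivAt (fun s : ℝ => T (archTestFunctions.rightTranslate (expGL (s • X) :) f))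
      (T (archTestFunctions.rightDeriv X f)) 0 := by
  have hT' := isArchDistribution_comp_compGKInvolution T hT
  have h := hT'.hasDerivAt_apply_leftTranslate_expGL (-weylSharp X) (archTestFunctions.compGKInvolution f)
  rw [leftDeriv_neg_weylSharp_compGKInvolution, ← apply_eq_comp_compGKInvolution] at h
  refine h.congr_of_eventuallyEq (Eventually.of_forall fun s => ?_)
  change T _ = (T.comp archTestFunctions.compGKInvolution) _
  rw [apply_eq_comp_compGKInvolution T, compGKInvolution_rightTranslate, gkInvolution_expGL_smul_inv]

/-- **Infinitesimal quasi-invariance, right**: if `T(ρ(exp sX) f) = e^{s c} · T f` for all real `s`, then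
`T(R_X f) = c · T f`. [cite: Shalika1974, §2] -/
theorem IsArchDistribution.apply_rightDeriv_eq_of_rightTranslate_expGL (hT : IsArchDistribution n K T) {X : Mat}
    {c : ℂ} (f : ↥(archTestFunctions n K))
    (h : ∀ s : ℝ, T (archTestFunctions.rightTranslate (expGL (s • X) :) f) = Complex.exp (s * c) * T f) :
    T (archTestFunctions.rightDeriv X f) = c * T f := by
  have h1 := hT.hasDerivAt_apply_rightTranslate_expGL X f
  have h2 : HasDerivAt (fun s : ℝ => Complex.exp (s * c) * T f) (c * T f) 0 := by
    have he : HasDerivAt (fun s : ℝ => Complex.exp (s * c)) (Complex.exp ((0 : ℝ) * c) * c) 0 := by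
      have hlin : HasDerivAt (fun s : ℝ => (s : ℂ) * c) c (0 : ℝ) := by
        simpa using (Complex.ofRealCLM.hasDerivAt (x := (0 : ℝ))).mul_const c
      exact (Complex.hasDerivAt_exp _).comp (0 : ℝ) hlin |>.congr_deriv (by ring)
    have := he.mul_const (T f)
    simpa using this
  simp_rw [h] at h1
  exact h1.unique h2

end Right

/-! ### 4. Root vectors: `ψ_∞`-quasi-invariance differentiated -/

section Roots

variable {T : ↥(archTestFunctions n K) →ₗ[ℂ] ℂ}

/-- **`ψ_∞(exp(s x E_{ij})) = exp(s ψ_∞'(x E_{ij}))`** for `i < j` (closed form of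
`archWhittakerChar_of_coe_eq_transvection`). [folklore] -/
theorem archWhittakerChar_expGL_smul_single {i j : Fin n} (hij : i < j) (x : R∞) (s : ℝ)
    (u : ↥(upperUnitriangular (Fin n) (mixedSpace K))) (hu : (u : G∞) = (expGL (s • Matrix.single i j x) :)) :
    archWhittakerChar n K u = Complex.exp ((s : ℂ) * archWhittakerDChar K i j x) := by
  rw [archWhittakerChar_of_coe_eq_transvection K (s • x) u (by rw [hu, coe_expGL_smul_single hij.ne x s])]
  unfold archWhittakerDChar
  split_ifs with h
  · congr 1
    rw [map_smul, smul_eq_mul]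
    push_cast
    ring
  · rw [mul_zero, Complex.exp_zero]

/-- **`T(L_{x E_{ij}} f) = ψ_∞'(x E_{ij}) · T f`** for a left `(N_∞, ψ_∞)`-quasi-invariant distribution and a
root vector `x E_{ij}`, `i < j`: `exp(s x E_{ij}) = 1 + s x E_{ij} ∈ N_∞` and
`ψ_∞(1 + s x E_{ij}) = exp(s ψ_∞'(x E_{ij}))`, `ψ_∞'(x E_{ij}) = -2πi Tr_{K_∞/ℝ}(x) [j = i + 1]`
(`archWhittakerDChar`). [cite: Shalika1974, §2] -/
theorem IsArchDistribution.apply_leftDeriv_single_of_leftQuasiInvariant (hT : IsArchDistribution n K T)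
    (hL : ∀ (u : ↥(upperUnitriangular (Fin n) (mixedSpace K))) (f : ↥(archTestFunctions n K)),
      T (archTestFunctions.leftTranslate (u : G∞) f) = archWhittakerChar n K u * T f)
    {i j : Fin n} (hij : i < j) (x : R∞) (f : ↥(archTestFunctions n K)) :
    T (archTestFunctions.leftDeriv (Matrix.single i j x) f) = archWhittakerDChar K i j x * T f := by
  refine hT.apply_leftDeriv_eq_of_leftTranslate_expGL f fun s => ?_
  obtain ⟨u, hu⟩ := exists_upperUnitriangular_coe_eq_expGL_smul_single hij x s
  rw [← hu, hL u f, archWhittakerChar_expGL_smul_single hij x s u hu]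

/-- **`T(R_{x E_{ij}} f) = -ψ_∞'(x E_{ij}) · T f`** for a right `(N_∞, ψ_∞⁻¹)`-quasi-invariant distribution
and a root vector `x E_{ij}`, `i < j`. [cite: Shalika1974, §2] -/
theorem IsArchDistribution.apply_rightDeriv_single_of_rightQuasiInvariant (hT : IsArchDistribution n K T)
    (hR : ∀ (u : ↥(upperUnitriangular (Fin n) (mixedSpace K))) (f : ↥(archTestFunctions n K)),
      T (archTestFunctions.rightTranslate (u : G∞) f) = (archWhittakerChar n K u)⁻¹ * T f)
    {i j : Fin n} (hij : i < j) (x : R∞) (f : ↥(archTestFunctions n K)) :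
    T (archTestFunctions.rightDeriv (Matrix.single i j x) f) = -archWhittakerDChar K i j x * T f := by
  refine hT.apply_rightDeriv_eq_of_rightTranslate_expGL f fun s => ?_
  obtain ⟨u, hu⟩ := exists_upperUnitriangular_coe_eq_expGL_smul_single hij x s
  rw [← hu, hR u f, archWhittakerChar_expGL_smul_single hij x s u hu, ← Complex.exp_neg]
  congr 2
  ring

end Roots

end Literature.NumberTheory.Automorphic
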